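import Summits.QuantumFields.YangMills.Theorems.FluctuationComparisonRegPrIntLS2BetaContractingSupRecursion
import HarnessLib

/-!
# The CONTRACTING sup recursion with a NON-ZERO START: `s m ≤ σ`, `s t ≤ r₀·s (t+1) + ρ t + C₂·s (t+1)²` ⟹ every level `≤ M`,
# the linearised contraction with ratio `r₀ + C₂·M`, and the budgets `Σ_{t<m} s (t+1) ≤ (r·s m + Σρ)/(1 − r) + s m`,
# `Σ_{t<m} s (t+1)² ≤ M·Σ_{t<m} s (t+1)` — what the (L♭) chart letter of the (D♮) two-tower road consumes over a NON-FLAT datum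

Cell `ym3-torus` (rung R3 = continuum `SU(2)` Yang–Mills on the three-torus — NOT d = 4, NOT infinite volume, NOT a mass gap, NOT Clay).
Width seat «width 12» `ym3-torus-px12` (gen 24); `--kind proof --supports stmt-QuantumFields-20520 --as helper`, count-neutral, DEFINITION-FREE
(0 `def`, 0 `instance`, 0 `notation`, 0 `sorry`, default heartbeats).  Mathlib-only real-sequence algebra on top of px16 g20's
✓`…S2BetaContractingSupRecursion` (which is the `s m = 0` edition: `sup_bootstrap`, `linearised_of_bootstrap`, `sum_le_of_contract`, `sum_succ_le_of_contract`).

WHY (UV3-NODE §84.3∕§84.4, this seat).  On the (D♮) road the two stage towers sit over the DATUM `V`, not over `1`: the sup profile of each tower starts at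
`s m = σ` := the bond size of `V` in its gauge (✓p822838 `…S2BetaDatumGaugeWLOG` lets the dischargers choose that gauge), NOT at `0` as in the `hFlat` road
(px17 ✓`…RelativeTowerSupProfile.exists_supProfile_relativeTower`'s `htop : U′ m = 1`, px16's `sup_bootstrap`'s `hs : s m = 0`).  The same downward
induction closes provided the START is below the bootstrap ceiling `M` (`σ ≤ M`, `C₂·M ≤ (1 − r₀)∕2`, `Σρ ≤ (1 − r₀)·M∕2`): every level stays `≤ M`, the
step linearises with the CONSTANT ratio `r := r₀ + C₂·M ≤ (1 + r₀)∕2 < 1`, and the sums pick up exactly one extra `s m`-term.  The consumer is this seat's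
✓∕⧗ `…S2BetaChartLetterOfSupProfile.chartLetter_of_supProfile` (budget `Σ_{j<m} s_{j+1}² ≤ 3E`, guards `s_t² ≤ 3`).
* §1 `sup_bootstrap_start` (every level `≤ M`), `linearised_of_bootstrap_start` (ratio `r₀ + C₂·M`).
* §2 `sum_le_of_contract_start`, `sum_succ_le_of_contract_start` (the sums with the `s m`-term), `sum_sq_succ_le_mul_sum_succ` (`Σ s² ≤ M·Σ s`),
  ★★ `sq_budget_of_start` (all in one: `Σ_{t<m} s (t+1)² ≤ M·((r·s m + Σρ)∕(1 − r) + s m)`).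

HONEST SCOPE.  Elementary inequalities; nothing of Bałaban's analysis is asserted ([Balaban1985RegularSpaces] (1.29) p.81 is where the local axial-gauge sup
sizes live); the T³ supplier of the step (`arc_le_sup_step_hatLift`'s constants `r₀ = L⁻¹`, `C₂ = 12π(L² − 1)∕L²` at `d = 3`, hence `M ≈ (1 − L⁻¹)∕(2C₂)`) and
the datum's small-bond gauge are NOT supplied here; (L♭) along the towers, (H♭), (D♮), GAP♯∘, S2β, crux 20520 and `YM3TorusSU2` are NOT proved; rung R3 =
SU(2) YM₃ on T³ — NOT d = 4, NOT infinite volume, NOT a mass gap, NOT Clay; the Yang–Mills mass gap is NOT proved.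
-/

set_option autoImplicit false

namespace Summit.QuantumFields.YangMills.Theorems.FluctuationComparisonRegPrIntLS2BetaContractingSupStart

open Finset
open Summit.QuantumFields.YangMills.Theorems.FluctuationComparisonRegPrIntLS2BetaContractingSupRecursion (le_of_sum_le_of_nonneg)

/-! ## §1. The bootstrap from a start `s m ≤ M` -/

/-- ★ **BOOTSTRAP WITH A NON-ZERO START**: `s m ≤ M`, `0 ≤ s`, `0 ≤ ρ`, `Σ_{t<m} ρ t ≤ Sρ`, the guarded quadratic step
`s (t+1) ≤ σ₀ → s t ≤ r₀·s (t+1) + ρ t + C₂·s (t+1)²` (`t < m`), `0 ≤ r₀ < 1`, `0 ≤ C₂`, and the ceiling conditions `M ≤ σ₀`, `Sρ ≤ (1 − r₀)∕2·M`,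
`C₂·M ≤ (1 − r₀)∕2` ⟹ EVERY level `s t ≤ M` (`t ≤ m`; downward induction: `r₀M + Sρ + C₂M² ≤ M`). [folklore] -/
theorem sup_bootstrap_start (s ρ : ℕ → ℝ) (m : ℕ) (r₀ C₂ σ₀ M Sρ : ℝ) (hs : s m ≤ M) (hsnn : ∀ t, 0 ≤ s t)
    (hρ : ∀ t, 0 ≤ ρ t) (hSρ : ∑ t ∈ range m, ρ t ≤ Sρ)
    (hstep : ∀ t, t < m → s (t + 1) ≤ σ₀ → s t ≤ r₀ * s (t + 1) + ρ t + C₂ * s (t + 1) ^ 2)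
    (hr0 : 0 ≤ r₀) (hC : 0 ≤ C₂) (hMσ : M ≤ σ₀)
    (hsmall₁ : Sρ ≤ (1 - r₀) / 2 * M) (hsmall₂ : C₂ * M ≤ (1 - r₀) / 2) :
    ∀ t, t ≤ m → s t ≤ M := by
  suffices h : ∀ k, ∀ t, t + k = m → s t ≤ M by
    intro t ht
    exact h (m - t) t (by omega)
  intro k
  induction k with
  | zero =>
    intro t ht
    have htm : t = m := by omega
    rw [htm]
    exact hs
  | succ k ih =>
    intro t ht
    have ht' : t < m := by omega
    have hS : s (t + 1) ≤ M := ih (t + 1) (by omega)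
    have hS0 : 0 ≤ s (t + 1) := hsnn (t + 1)
    have h1 : r₀ * s (t + 1) ≤ r₀ * M := mul_le_mul_of_nonneg_left hS hr0
    have h2 : C₂ * s (t + 1) ^ 2 ≤ C₂ * (M * M) := mul_le_mul_of_nonneg_left (by nlinarith) hC
    have h3 : C₂ * (M * M) ≤ (1 - r₀) / 2 * M := by nlinarith
    calc s t ≤ r₀ * s (t + 1) + ρ t + C₂ * s (t + 1) ^ 2 := hstep t ht' (hS.trans hMσ)
      _ ≤ r₀ * M + Sρ + (1 - r₀) / 2 * M := by linarith [le_of_sum_le_of_nonneg ρ m Sρ hρ hSρ t ht']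
      _ ≤ r₀ * M + (1 - r₀) / 2 * M + (1 - r₀) / 2 * M := by linarith
      _ = M := by ring

/-- ★ **THE LINEARISED STEP** after the bootstrap: `s t ≤ (r₀ + C₂·M)·s (t+1) + ρ t` (`t < m`) with `0 ≤ r₀ + C₂·M ≤ (1 + r₀)∕2 < 1`. [folklore] -/
theorem linearised_of_bootstrap_start (s ρ : ℕ → ℝ) (m : ℕ) (r₀ C₂ σ₀ M Sρ : ℝ) (hs : s m ≤ M) (hsnn : ∀ t, 0 ≤ s t)
    (hρ : ∀ t, 0 ≤ ρ t) (hSρ : ∑ t ∈ range m, ρ t ≤ Sρ)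
    (hstep : ∀ t, t < m → s (t + 1) ≤ σ₀ → s t ≤ r₀ * s (t + 1) + ρ t + C₂ * s (t + 1) ^ 2)
    (hr0 : 0 ≤ r₀) (hr1 : r₀ < 1) (hC : 0 ≤ C₂) (hMσ : M ≤ σ₀)
    (hsmall₁ : Sρ ≤ (1 - r₀) / 2 * M) (hsmall₂ : C₂ * M ≤ (1 - r₀) / 2) :
    0 ≤ r₀ + C₂ * M ∧ r₀ + C₂ * M < 1 ∧ ∀ t, t < m → s t ≤ (r₀ + C₂ * M) * s (t + 1) + ρ t := by
  have hM0 : 0 ≤ M := (hsnn m).trans hs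
  refine ⟨add_nonneg hr0 (mul_nonneg hC hM0), by linarith, fun t ht => ?_⟩
  have hS : s (t + 1) ≤ M := sup_bootstrap_start s ρ m r₀ C₂ σ₀ M Sρ hs hsnn hρ hSρ hstep hr0 hC hMσ hsmall₁ hsmall₂ (t + 1) (by omega)
  have hS0 : 0 ≤ s (t + 1) := hsnn (t + 1)
  have h2 : C₂ * s (t + 1) ^ 2 ≤ C₂ * M * s (t + 1) := by
    rw [mul_assoc]; exact mul_le_mul_of_nonneg_left (by nlinarith) hC
  calc s t ≤ r₀ * s (t + 1) + ρ t + C₂ * s (t + 1) ^ 2 := hstep t ht (hS.trans hMσ)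
    _ ≤ r₀ * s (t + 1) + ρ t + C₂ * M * s (t + 1) := by linarith
    _ = (r₀ + C₂ * M) * s (t + 1) + ρ t := by ring

/-! ## §2. The sums of a contracting recursion with a non-zero start -/

/-- **SUMMING WITH A START**: `0 ≤ s`, `s t ≤ r·s (t+1) + ρ t` (`t < m`), `0 ≤ r < 1` ⟹ `Σ_{t<m} s t ≤ (r·s m + Σ_{t<m} ρ t)∕(1 − r)`
(the shifted sum is the sum minus `s 0` plus `s m`). [folklore] -/
theorem sum_le_of_contract_start (r : ℝ) (hr0 : 0 ≤ r) (hr1 : r < 1) (s ρ : ℕ → ℝ) (m : ℕ)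
    (hs0 : ∀ t, 0 ≤ s t) (hrec : ∀ t, t < m → s t ≤ r * s (t + 1) + ρ t) :
    ∑ t ∈ range m, s t ≤ (r * s m + ∑ t ∈ range m, ρ t) / (1 - r) := by
  have h1 : ∑ t ∈ range m, s t ≤ r * ∑ t ∈ range m, s (t + 1) + ∑ t ∈ range m, ρ t := by
    rw [Finset.mul_sum, ← Finset.sum_add_distrib]
    exact Finset.sum_le_sum fun t ht => hrec t (Finset.mem_range.mp ht)
  have h2 : ∑ t ∈ range m, s (t + 1) = ∑ t ∈ range m, s t - s 0 + s m := by
    have ha := Finset.sum_range_succ' s m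
    have hb := Finset.sum_range_succ s m
    linarith
  rw [h2] at h1
  have h3 : r * (∑ t ∈ range m, s t - s 0 + s m) ≤ r * ∑ t ∈ range m, s t + r * s m := by
    have : 0 ≤ r * s 0 := mul_nonneg hr0 (hs0 0)
    nlinarith
  have h1r : 0 < 1 - r := by linarith
  rw [le_div_iff₀ h1r]
  nlinarith

/-- The shifted sum: `Σ_{t<m} s (t+1) ≤ (r·s m + Σ_{t<m} ρ t)∕(1 − r) + s m`. [folklore] -/
theorem sum_succ_le_of_contract_start (r : ℝ) (hr0 : 0 ≤ r) (hr1 : r < 1) (s ρ : ℕ → ℝ) (m : ℕ)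
    (hs0 : ∀ t, 0 ≤ s t) (hrec : ∀ t, t < m → s t ≤ r * s (t + 1) + ρ t) :
    ∑ t ∈ range m, s (t + 1) ≤ (r * s m + ∑ t ∈ range m, ρ t) / (1 - r) + s m := by
  have h2 : ∑ t ∈ range m, s (t + 1) = ∑ t ∈ range m, s t - s 0 + s m := by
    have ha := Finset.sum_range_succ' s m
    have hb := Finset.sum_range_succ s m
    linarith
  have h := sum_le_of_contract_start r hr0 hr1 s ρ m hs0 hrec
  have := hs0 0
  rw [h2]
  linarith

/-- `0 ≤ s (t+1) ≤ M` at every `t < m` ⟹ `Σ_{t<m} s (t+1)² ≤ M·Σ_{t<m} s (t+1)`. [folklore] -/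
theorem sum_sq_succ_le_mul_sum_succ (s : ℕ → ℝ) (m : ℕ) (M : ℝ) (hs0 : ∀ t, 0 ≤ s t) (hM : ∀ t, t ≤ m → s t ≤ M) :
    ∑ t ∈ range m, s (t + 1) ^ 2 ≤ M * ∑ t ∈ range m, s (t + 1) := by
  rw [Finset.mul_sum]
  refine Finset.sum_le_sum fun t ht => ?_
  have h := hM (t + 1) (by have := Finset.mem_range.mp ht; omega)
  have h0 := hs0 (t + 1)
  nlinarith

/-- ★★ **THE SQUARE BUDGET FROM A START** — the (L♭) consumer's currency: under the hypotheses of `sup_bootstrap_start` (with `r₀ < 1`),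
`Σ_{t<m} s (t+1)² ≤ M·((r·s m + Σ_{t<m} ρ t)∕(1 − r) + s m)` with `r := r₀ + C₂·M`; and every level `≤ M`. [folklore] -/
theorem sq_budget_of_start (s ρ : ℕ → ℝ) (m : ℕ) (r₀ C₂ σ₀ M Sρ : ℝ) (hs : s m ≤ M) (hsnn : ∀ t, 0 ≤ s t)
    (hρ : ∀ t, 0 ≤ ρ t) (hSρ : ∑ t ∈ range m, ρ t ≤ Sρ)
    (hstep : ∀ t, t < m → s (t + 1) ≤ σ₀ → s t ≤ r₀ * s (t + 1) + ρ t + C₂ * s (t + 1) ^ 2)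
    (hr0 : 0 ≤ r₀) (hr1 : r₀ < 1) (hC : 0 ≤ C₂) (hMσ : M ≤ σ₀)
    (hsmall₁ : Sρ ≤ (1 - r₀) / 2 * M) (hsmall₂ : C₂ * M ≤ (1 - r₀) / 2) :
    (∀ t, t ≤ m → s t ≤ M) ∧
      ∑ t ∈ range m, s (t + 1) ^ 2 ≤ M * (((r₀ + C₂ * M) * s m + ∑ t ∈ range m, ρ t) / (1 - (r₀ + C₂ * M)) + s m) := by
  have hall := sup_bootstrap_start s ρ m r₀ C₂ σ₀ M Sρ hs hsnn hρ hSρ hstep hr0 hC hMσ hsmall₁ hsmall₂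
  obtain ⟨hq0, hq1, hlin⟩ := linearised_of_bootstrap_start s ρ m r₀ C₂ σ₀ M Sρ hs hsnn hρ hSρ hstep hr0 hr1 hC hMσ hsmall₁ hsmall₂
  have hM0 : 0 ≤ M := (hsnn m).trans hs
  refine ⟨hall, (sum_sq_succ_le_mul_sum_succ s m M hsnn hall).trans ?_⟩
  exact mul_le_mul_of_nonneg_left (sum_succ_le_of_contract_start _ hq0 hq1 s ρ m hsnn hlin) hM0

end Summit.QuantumFields.YangMills.Theorems.FluctuationComparisonRegPrIntLS2BetaContractingSupStart
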